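import Summits.ResolutionOfSingularities.ResolutionOfSingularities.Theorems.FrobeniusLadderFInjectiveMacaulayficationDiagonalCITriple
import Summits.ResolutionOfSingularities.ResolutionOfSingularities.Theorems.FrobeniusLadderFInjectiveMacaulayficationMonicTowerThreePrime
import Summits.ResolutionOfSingularities.ResolutionOfSingularities.Theorems.FrobeniusLadderFInjectiveMacaulayficationDiagonalBPCIChartsCM
import Summits.ResolutionOfSingularities.ResolutionOfSingularities.Theorems.FrobeniusLadderFInjectiveMacaulayficationDiagonalBPCIRow
import HarnessLib

/-!
# BED CI-2 (codimension THREE): the diagonal Brieskorn–Pham TRIPLE `X = V(F₀, F₁, F₂) ⊂ 𝔸⁷`, `F_l = Σᵢ c_{l,i} xᵢ^{aᵢ}`, `a = (2,3,5,3,4,7,7)`,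
# coefficient rows `(1,…,1)`, `(1,2,…,7)`, `(1,4,…,49)` — the class hypotheses: PRIME (three-step monic tower), equal supports, convenient, geometric Khovanskii-ND, `x̄ᵥ ≠ 0`,
# regular off the vertex (`char k = p ≥ 11`)
# (crux `FInjectiveMacaulayfication` stmt-ResolutionOfSingularities-15315, chain w45a; res-L1-w45a-plan-1 RULING R23.22 (β) «a second equal-support bed of DIFFERENT CODIMENSION»;
# seat res-L1-w45a-stub-2 g13)

[OURS · L1 W4.5a] Support file (`--supports stmt-ResolutionOfSingularities-15315 --as helper`); def-free; UNCONDITIONAL; no named fact, no sorry; NOT a statement of any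
manuscript; replaces the role of NO printed item. Nothing of the crux is proved. AI-written (AI review weaker than expert review).

* §1 `no_power_of_spec` (specialisation mechanism, any exponent); the data `a`, `c₀, c₁, c₂`; `F_eq_sum`.
* §2 ★★ `isPrime_span_triple` (`2, 3 ≠ 0` in `k`): `(F₀, F₁, F₂) = (P₀, P₁, P₂)` with `2P₀ = 6F₀ − 5F₁ + F₂ = 2(x₀² + E₀)`, `P₁ = −3F₀ + 4F₁ − F₂ = x₁³ + E₁`,
  `2P₂ = 2F₀ − 3F₁ + F₂ = 2(x₂⁵ + E₂)`, `E₀ = y₃³+3y₄⁴+6y₅⁷+10y₆⁷`, `E₁ = −(3y₃³+8y₄⁴+15y₅⁷+24y₆⁷)`, `E₂ = 3y₃³+6y₄⁴+10y₅⁷+15y₆⁷`; the three-step tower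
  ✓ `MonicTowerThreePrime.isPrime_span_tower3` applies (`−E₂ ↦ −3t³` no fifth power, `−E₁ ↦ 8t⁴` no cube, `−E₀ ↦ −t³` no square).
* §3 `minors` (the `2 × 2` minors `j − i` and the Vandermonde `3 × 3` minors are non-zero for `p ≥ 11`), ★ `classHypotheses` — the six class hypotheses packaged.
[cite: CuetoPopescupampuStepanov2023, Def. 4.2] [cite: Matsumura1987, Thm. 30.4] [folklore: Kummer, Gauss, Vandermonde]
-/

-- single-problem summit: the doubled namespace component is forced
set_option linter.dupNamespace false

noncomputable section

open MvPolynomial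

namespace Summit.ResolutionOfSingularities.ResolutionOfSingularities.Theorems.FInjectiveMacaulayfication.DiagonalBPTripleSpecimen

open Summit.ResolutionOfSingularities.ResolutionOfSingularities.Theorems.FInjectiveMacaulayfication
open Literature.AlgebraicGeometry.Resolution Literature.AlgebraicGeometry.Resolution.BoubakriGreuelMarkwig CINondegenerate

variable (k : Type) [Field k]

/-! ## §1 Specialisations; the data -/

/-- **No `m`-th root by specialisation**: if `s : C → k[t]` sends `H` to a polynomial of degree not divisible by `m`, then `y^m + H ≠ 0` for all `y ∈ C`. [elementary] -/
theorem no_power_of_spec (m : ℕ) (H : MvPolynomial (Fin 4) k) (s : MvPolynomial (Fin 4) k →+* Polynomial k) (q : Polynomial k) (hs : s H = q) (N : ℕ)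
    (hq : q.natDegree = N) (hN : ¬ m ∣ N) (y : MvPolynomial (Fin 4) k) : y ^ m + H ≠ 0 := by
  intro h0
  have h1 := congrArg s h0
  rw [map_add, map_pow, hs, map_zero] at h1
  have h2 := congrArg Polynomial.natDegree (eq_neg_of_add_eq_zero_left h1)
  rw [Polynomial.natDegree_pow, Polynomial.natDegree_neg, hq] at h2
  exact hN ⟨_, by rw [← h2, mul_comm]⟩

/-- `F_l = Σ c_{l,i} xᵢ^{aᵢ}` in `Σ`-form for the three coefficient rows. [plumbing] -/
theorem F_eq_sum (F : Fin 3 → MvPolynomial (Fin 7) k)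
    (hF0 : F 0 = X 0 ^ 2 + X 1 ^ 3 + X 2 ^ 5 + X 3 ^ 3 + X 4 ^ 4 + X 5 ^ 7 + X 6 ^ 7)
    (hF1 : F 1 = X 0 ^ 2 + C 2 * X 1 ^ 3 + C 3 * X 2 ^ 5 + C 4 * X 3 ^ 3 + C 5 * X 4 ^ 4 + C 6 * X 5 ^ 7 + C 7 * X 6 ^ 7)
    (hF2 : F 2 = X 0 ^ 2 + C 4 * X 1 ^ 3 + C 9 * X 2 ^ 5 + C 16 * X 3 ^ 3 + C 25 * X 4 ^ 4 + C 36 * X 5 ^ 7 + C 49 * X 6 ^ 7) :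
    (F 0 = ∑ i : Fin 7, monomial (Finsupp.single i ((![2, 3, 5, 3, 4, 7, 7] : Fin 7 → ℕ) i)) ((fun _ : Fin 7 => (1 : k)) i)) ∧
    (F 1 = ∑ i : Fin 7, monomial (Finsupp.single i ((![2, 3, 5, 3, 4, 7, 7] : Fin 7 → ℕ) i)) ((fun i : Fin 7 => (((i : ℕ) + 1 : ℕ) : k)) i)) ∧
    (F 2 = ∑ i : Fin 7, monomial (Finsupp.single i ((![2, 3, 5, 3, 4, 7, 7] : Fin 7 → ℕ) i)) ((fun i : Fin 7 => ((((i : ℕ) + 1) ^ 2 : ℕ) : k)) i)) := by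
  refine ⟨?_, ?_, ?_⟩
  · rw [hF0]; simp only [Fin.sum_univ_seven, Matrix.cons_val_zero, Matrix.cons_val_one, Matrix.cons_val, X_pow_eq_monomial]
  · rw [hF1]; simp only [Fin.sum_univ_seven, Matrix.cons_val_zero, Matrix.cons_val_one, Matrix.cons_val, ← C_mul_X_pow_eq_monomial]; norm_num
  · rw [hF2]; simp only [Fin.sum_univ_seven, Matrix.cons_val_zero, Matrix.cons_val_one, Matrix.cons_val, ← C_mul_X_pow_eq_monomial]; norm_num

/-! ## §2 ★★ `(F₀, F₁, F₂)` is prime: the three-step tower -/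

/-- `−E₂` is not a fifth power (`E₂ ↦ 3t³` under `y₃ ↦ t`; `3 ≠ 0`). [elementary] -/
theorem no_fifth_E₂ (h3 : (3 : k) ≠ 0) (y : MvPolynomial (Fin 4) k) :
    y ^ 5 + (C 3 * X 0 ^ 3 + C 6 * X 1 ^ 4 + C 10 * X 2 ^ 7 + C 15 * X 3 ^ 7 : MvPolynomial (Fin 4) k) ≠ 0 := by
  refine no_power_of_spec k 5 _ (MvPolynomial.eval₂Hom (Polynomial.C : k →+* Polynomial k) (![Polynomial.X, 0, 0, 0] : Fin 4 → Polynomial k))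
    (Polynomial.C 3 * Polynomial.X ^ 3) ?_ 3 (Polynomial.natDegree_C_mul_X_pow 3 (3 : k) h3) (by norm_num) y
  simp only [map_add, map_mul, map_pow, MvPolynomial.eval₂Hom_X', MvPolynomial.eval₂Hom_C, Matrix.cons_val_zero, Matrix.cons_val_one, Matrix.cons_val]
  ring

/-- `−E₁` is not a cube (`E₁ ↦ −8t⁴` under `y₄ ↦ t`; `8 ≠ 0`). [elementary] -/
theorem no_cube_E₁ (h8 : (8 : k) ≠ 0) (y : MvPolynomial (Fin 4) k) :
    y ^ 3 + (-(C 3 * X 0 ^ 3 + C 8 * X 1 ^ 4 + C 15 * X 2 ^ 7 + C 24 * X 3 ^ 7) : MvPolynomial (Fin 4) k) ≠ 0 := by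
  refine no_power_of_spec k 3 _ (MvPolynomial.eval₂Hom (Polynomial.C : k →+* Polynomial k) (![0, Polynomial.X, 0, 0] : Fin 4 → Polynomial k))
    (Polynomial.C (-8) * Polynomial.X ^ 4) ?_ 4 (Polynomial.natDegree_C_mul_X_pow 4 (-8 : k) (neg_ne_zero.mpr h8)) (by norm_num) y
  simp only [map_add, map_neg, map_mul, map_pow, MvPolynomial.eval₂Hom_X', MvPolynomial.eval₂Hom_C, Matrix.cons_val_zero, Matrix.cons_val_one, Matrix.cons_val]
  ring

/-- `−E₀` is not a square (`E₀ ↦ t³` under `y₃ ↦ t`; no hypothesis on `k`). [elementary] -/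
theorem no_square_E₀ (y : MvPolynomial (Fin 4) k) :
    y ^ 2 + (X 0 ^ 3 + C 3 * X 1 ^ 4 + C 6 * X 2 ^ 7 + C 10 * X 3 ^ 7 : MvPolynomial (Fin 4) k) ≠ 0 := by
  refine no_power_of_spec k 2 _ (MvPolynomial.eval₂Hom (Polynomial.C : k →+* Polynomial k) (![Polynomial.X, 0, 0, 0] : Fin 4 → Polynomial k))
    (Polynomial.X ^ 3) ?_ 3 (Polynomial.natDegree_X_pow 3) (by norm_num) y
  simp only [map_add, map_mul, map_pow, MvPolynomial.eval₂Hom_X', MvPolynomial.eval₂Hom_C, Matrix.cons_val_zero, Matrix.cons_val_one, Matrix.cons_val]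
  ring

section Bed

variable (F : Fin 3 → MvPolynomial (Fin 7) k)
  (hF0 : F 0 = X 0 ^ 2 + X 1 ^ 3 + X 2 ^ 5 + X 3 ^ 3 + X 4 ^ 4 + X 5 ^ 7 + X 6 ^ 7)
  (hF1 : F 1 = X 0 ^ 2 + C 2 * X 1 ^ 3 + C 3 * X 2 ^ 5 + C 4 * X 3 ^ 3 + C 5 * X 4 ^ 4 + C 6 * X 5 ^ 7 + C 7 * X 6 ^ 7)
  (hF2 : F 2 = X 0 ^ 2 + C 4 * X 1 ^ 3 + C 9 * X 2 ^ 5 + C 16 * X 3 ^ 3 + C 25 * X 4 ^ 4 + C 36 * X 5 ^ 7 + C 49 * X 6 ^ 7)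
include hF0 hF1 hF2

set_option linter.unusedSimpArgs false in
-- one `simp only` set serves the six ideal-membership identities
/-- ★★ **`(F₀, F₁, F₂) ⊂ k[x₀, …, x₆]` IS PRIME** when `2, 3 ≠ 0` in `k` (so for every field of characteristic `≥ 5`): row reduction to the monic three-step tower
`(x₀² + E₀, x₁³ + E₁, x₂⁵ + E₂)` (✓ `MonicTowerThreePrime.isPrime_span_tower3`). [OURS · elementary certificate; folklore] -/
theorem isPrime_span_triple (h2 : (2 : k) ≠ 0) (h3 : (3 : k) ≠ 0) : (Ideal.span (Set.range F)).IsPrime := by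
  have h8 : (8 : k) ≠ 0 := by
    have : (8 : k) = 2 * 2 * 2 := by norm_num
    rw [this]; exact mul_ne_zero (mul_ne_zero h2 h2) h2
  set ι : MvPolynomial (Fin 4) k →+* MvPolynomial (Fin 7) k :=
    MvPolynomial.eval₂Hom MvPolynomial.C ![MvPolynomial.X 3, MvPolynomial.X 4, MvPolynomial.X 5, MvPolynomial.X 6] with hι
  obtain ⟨E₀, hE₀⟩ : ∃ E₀ : MvPolynomial (Fin 4) k, E₀ = X 0 ^ 3 + C 3 * X 1 ^ 4 + C 6 * X 2 ^ 7 + C 10 * X 3 ^ 7 := ⟨_, rfl⟩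
  obtain ⟨E₁, hE₁⟩ : ∃ E₁ : MvPolynomial (Fin 4) k, E₁ = -(C 3 * X 0 ^ 3 + C 8 * X 1 ^ 4 + C 15 * X 2 ^ 7 + C 24 * X 3 ^ 7) := ⟨_, rfl⟩
  obtain ⟨E₂, hE₂⟩ : ∃ E₂ : MvPolynomial (Fin 4) k, E₂ = C 3 * X 0 ^ 3 + C 6 * X 1 ^ 4 + C 10 * X 2 ^ 7 + C 15 * X 3 ^ 7 := ⟨_, rfl⟩
  have hιE₀ : ι E₀ = X 3 ^ 3 + C 3 * X 4 ^ 4 + C 6 * X 5 ^ 7 + C 10 * X 6 ^ 7 := by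
    rw [hE₀, hι]; simp only [map_add, map_mul, map_pow, MvPolynomial.eval₂Hom_X', MvPolynomial.eval₂Hom_C, Matrix.cons_val_zero, Matrix.cons_val_one, Matrix.cons_val]
  have hιE₁ : ι E₁ = -(C 3 * X 3 ^ 3 + C 8 * X 4 ^ 4 + C 15 * X 5 ^ 7 + C 24 * X 6 ^ 7) := by
    rw [hE₁, hι]; simp only [map_neg, map_add, map_mul, map_pow, MvPolynomial.eval₂Hom_X', MvPolynomial.eval₂Hom_C, Matrix.cons_val_zero, Matrix.cons_val_one, Matrix.cons_val]
  have hιE₂ : ι E₂ = C 3 * X 3 ^ 3 + C 6 * X 4 ^ 4 + C 10 * X 5 ^ 7 + C 15 * X 6 ^ 7 := by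
    rw [hE₂, hι]; simp only [map_add, map_mul, map_pow, MvPolynomial.eval₂Hom_X', MvPolynomial.eval₂Hom_C, Matrix.cons_val_zero, Matrix.cons_val_one, Matrix.cons_val]
  -- the two spans coincide
  have hI : Ideal.span (Set.range F) = Ideal.span {(X 0 : MvPolynomial (Fin 7) k) ^ 2 + ι E₀, (X 1 : MvPolynomial (Fin 7) k) ^ 3 + ι E₁,
      (X 2 : MvPolynomial (Fin 7) k) ^ 5 + ι E₂} := by
    have hF : ∀ l, F l ∈ Ideal.span (Set.range F) := fun l => Ideal.subset_span ⟨l, rfl⟩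
    apply le_antisymm
    · rw [Ideal.span_le]
      rintro _ ⟨l, rfl⟩
      have hP0 : (X 0 : MvPolynomial (Fin 7) k) ^ 2 + ι E₀ ∈ Ideal.span {(X 0 : MvPolynomial (Fin 7) k) ^ 2 + ι E₀, (X 1 : MvPolynomial (Fin 7) k) ^ 3 + ι E₁,
          (X 2 : MvPolynomial (Fin 7) k) ^ 5 + ι E₂} := Ideal.subset_span (Or.inl rfl)
      have hP1 : (X 1 : MvPolynomial (Fin 7) k) ^ 3 + ι E₁ ∈ Ideal.span {(X 0 : MvPolynomial (Fin 7) k) ^ 2 + ι E₀, (X 1 : MvPolynomial (Fin 7) k) ^ 3 + ι E₁,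
          (X 2 : MvPolynomial (Fin 7) k) ^ 5 + ι E₂} := Ideal.subset_span (Or.inr (Or.inl rfl))
      have hP2 : (X 2 : MvPolynomial (Fin 7) k) ^ 5 + ι E₂ ∈ Ideal.span {(X 0 : MvPolynomial (Fin 7) k) ^ 2 + ι E₀, (X 1 : MvPolynomial (Fin 7) k) ^ 3 + ι E₁,
          (X 2 : MvPolynomial (Fin 7) k) ^ 5 + ι E₂} := Ideal.subset_span (Or.inr (Or.inr rfl))
      rw [SetLike.mem_coe]
      fin_cases l
      · have e : F 0 = ((X 0 : MvPolynomial (Fin 7) k) ^ 2 + ι E₀) + ((X 1 : MvPolynomial (Fin 7) k) ^ 3 + ι E₁) + ((X 2 : MvPolynomial (Fin 7) k) ^ 5 + ι E₂) := by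
          rw [hιE₀, hιE₁, hιE₂, hF0]; simp only [map_ofNat]; ring
        simp only [Fin.zero_eta]
        rw [e]; exact add_mem (add_mem hP0 hP1) hP2
      · have e : F 1 = ((X 0 : MvPolynomial (Fin 7) k) ^ 2 + ι E₀) + C 2 * ((X 1 : MvPolynomial (Fin 7) k) ^ 3 + ι E₁) + C 3 * ((X 2 : MvPolynomial (Fin 7) k) ^ 5 + ι E₂) := by
          rw [hιE₀, hιE₁, hιE₂, hF1]; simp only [map_ofNat]; ring
        simp only [Fin.mk_one]
        rw [e]; exact add_mem (add_mem hP0 (Ideal.mul_mem_left _ _ hP1)) (Ideal.mul_mem_left _ _ hP2)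
      · have e : F 2 = ((X 0 : MvPolynomial (Fin 7) k) ^ 2 + ι E₀) + C 4 * ((X 1 : MvPolynomial (Fin 7) k) ^ 3 + ι E₁) + C 9 * ((X 2 : MvPolynomial (Fin 7) k) ^ 5 + ι E₂) := by
          rw [hιE₀, hιE₁, hιE₂, hF2]; simp only [map_ofNat]; ring
        simp only [Fin.reduceFinMk]
        rw [e]; exact add_mem (add_mem hP0 (Ideal.mul_mem_left _ _ hP1)) (Ideal.mul_mem_left _ _ hP2)
    · rw [Ideal.span_le]
      rintro _ (rfl | rfl | rfl) <;> rw [SetLike.mem_coe]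
      · have e : (X 0 : MvPolynomial (Fin 7) k) ^ 2 + ι E₀ = C (2⁻¹) * (C 6 * F 0 - C 5 * F 1 + F 2) := by
          rw [hιE₀, hF0, hF1, hF2]
          have h22 : (C (2⁻¹ : k) : MvPolynomial (Fin 7) k) * 2 = 1 := by
            rw [show (2 : MvPolynomial (Fin 7) k) = C 2 by simp only [map_ofNat], ← map_mul, inv_mul_cancel₀ h2, map_one]
          simp only [map_ofNat]
          linear_combination (-(X 0 ^ 2 + X 3 ^ 3 + 3 * X 4 ^ 4 + 6 * X 5 ^ 7 + 10 * X 6 ^ 7 : MvPolynomial (Fin 7) k)) * h22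
        rw [e]; exact Ideal.mul_mem_left _ _ (add_mem (sub_mem (Ideal.mul_mem_left _ _ (hF 0)) (Ideal.mul_mem_left _ _ (hF 1))) (hF 2))
      · have e : (X 1 : MvPolynomial (Fin 7) k) ^ 3 + ι E₁ = -(C 3 * F 0) + C 4 * F 1 - F 2 := by
          rw [hιE₁, hF0, hF1, hF2]; simp only [map_ofNat]; ring
        rw [e]; exact sub_mem (add_mem (neg_mem (Ideal.mul_mem_left _ _ (hF 0))) (Ideal.mul_mem_left _ _ (hF 1))) (hF 2)
      · have e : (X 2 : MvPolynomial (Fin 7) k) ^ 5 + ι E₂ = C (2⁻¹) * (C 2 * F 0 - C 3 * F 1 + F 2) := by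
          rw [hιE₂, hF0, hF1, hF2]
          have h22 : (C (2⁻¹ : k) : MvPolynomial (Fin 7) k) * 2 = 1 := by
            rw [show (2 : MvPolynomial (Fin 7) k) = C 2 by simp only [map_ofNat], ← map_mul, inv_mul_cancel₀ h2, map_one]
          simp only [map_ofNat]
          linear_combination (-(X 2 ^ 5 + 3 * X 3 ^ 3 + 6 * X 4 ^ 4 + 10 * X 5 ^ 7 + 15 * X 6 ^ 7 : MvPolynomial (Fin 7) k)) * h22
        rw [e]; exact Ideal.mul_mem_left _ _ (add_mem (sub_mem (Ideal.mul_mem_left _ _ (hF 0)) (Ideal.mul_mem_left _ _ (hF 1))) (hF 2))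
  exact (MonicTowerThreePrime.isPrime_span_tower3 k E₀ E₁ E₂ (by rw [hE₀]; exact no_square_E₀ k) (by rw [hE₁]; exact no_cube_E₁ k h8)
    (by rw [hE₂]; exact no_fifth_E₂ k h3) _ hI).1

end Bed

/-! ## §3 The minors; the class hypotheses packaged -/

/-- **The coefficient minors are non-zero for `p ≥ 11`**: `2 × 2` minors `(j+1) − (i+1)` of the rows `(1, t)`, Vandermonde `3 × 3` minors `(t_l − t_j)(t_l − t_i)(t_j − t_i)` of
`(1, t, t²)`, `t = 1, …, 7`. [elementary] -/
theorem minors (p : ℕ) [Fact p.Prime] (hp : 11 ≤ p) [CharP k p] :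
    (∀ i j : Fin 7, i ≠ j → (fun _ : Fin 7 => (1 : k)) i * (fun i : Fin 7 => (((i : ℕ) + 1 : ℕ) : k)) j ≠
        (fun _ : Fin 7 => (1 : k)) j * (fun i : Fin 7 => (((i : ℕ) + 1 : ℕ) : k)) i) ∧
    (∀ i j l : Fin 7, i ≠ j → j ≠ l → i ≠ l →
      (fun _ : Fin 7 => (1 : k)) i * ((fun i : Fin 7 => (((i : ℕ) + 1 : ℕ) : k)) j * (fun i : Fin 7 => ((((i : ℕ) + 1) ^ 2 : ℕ) : k)) l -
          (fun i : Fin 7 => (((i : ℕ) + 1 : ℕ) : k)) l * (fun i : Fin 7 => ((((i : ℕ) + 1) ^ 2 : ℕ) : k)) j) -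
        (fun i : Fin 7 => (((i : ℕ) + 1 : ℕ) : k)) i * ((fun _ : Fin 7 => (1 : k)) j * (fun i : Fin 7 => ((((i : ℕ) + 1) ^ 2 : ℕ) : k)) l -
          (fun _ : Fin 7 => (1 : k)) l * (fun i : Fin 7 => ((((i : ℕ) + 1) ^ 2 : ℕ) : k)) j) +
        (fun i : Fin 7 => ((((i : ℕ) + 1) ^ 2 : ℕ) : k)) i * ((fun _ : Fin 7 => (1 : k)) j * (fun i : Fin 7 => (((i : ℕ) + 1 : ℕ) : k)) l -
          (fun _ : Fin 7 => (1 : k)) l * (fun i : Fin 7 => (((i : ℕ) + 1 : ℕ) : k)) j) ≠ 0) := by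
  have hinj : ∀ i j : Fin 7, (((i : ℕ) + 1 : ℕ) : k) = (((j : ℕ) + 1 : ℕ) : k) → i = j := by
    intro i j h
    have := CharP.natCast_injOn_Iio k p (by have := i.2; simp only [Set.mem_Iio]; omega) (by have := j.2; simp only [Set.mem_Iio]; omega) h
    exact Fin.ext (by omega)
  have hsub : ∀ i j : Fin 7, i ≠ j → ((((j : ℕ) + 1 : ℕ) : k) - (((i : ℕ) + 1 : ℕ) : k)) ≠ 0 :=
    fun i j hij h => hij (hinj i j (sub_eq_zero.mp h).symm)
  refine ⟨fun i j hij h => ?_, fun i j l hij hjl hil h => ?_⟩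
  · simp only [one_mul] at h
    exact hij (hinj i j h.symm)
  · have e : (fun _ : Fin 7 => (1 : k)) i * ((fun i : Fin 7 => (((i : ℕ) + 1 : ℕ) : k)) j * (fun i : Fin 7 => ((((i : ℕ) + 1) ^ 2 : ℕ) : k)) l -
          (fun i : Fin 7 => (((i : ℕ) + 1 : ℕ) : k)) l * (fun i : Fin 7 => ((((i : ℕ) + 1) ^ 2 : ℕ) : k)) j) -
        (fun i : Fin 7 => (((i : ℕ) + 1 : ℕ) : k)) i * ((fun _ : Fin 7 => (1 : k)) j * (fun i : Fin 7 => ((((i : ℕ) + 1) ^ 2 : ℕ) : k)) l -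
          (fun _ : Fin 7 => (1 : k)) l * (fun i : Fin 7 => ((((i : ℕ) + 1) ^ 2 : ℕ) : k)) j) +
        (fun i : Fin 7 => ((((i : ℕ) + 1) ^ 2 : ℕ) : k)) i * ((fun _ : Fin 7 => (1 : k)) j * (fun i : Fin 7 => (((i : ℕ) + 1 : ℕ) : k)) l -
          (fun _ : Fin 7 => (1 : k)) l * (fun i : Fin 7 => (((i : ℕ) + 1 : ℕ) : k)) j) =
        ((((l : ℕ) + 1 : ℕ) : k) - (((j : ℕ) + 1 : ℕ) : k)) * ((((l : ℕ) + 1 : ℕ) : k) - (((i : ℕ) + 1 : ℕ) : k)) * ((((j : ℕ) + 1 : ℕ) : k) - (((i : ℕ) + 1 : ℕ) : k)) := by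
      push_cast; ring
    rw [e] at h
    rcases mul_eq_zero.mp h with h12 | h3
    · rcases mul_eq_zero.mp h12 with h1 | h2
      · exact hsub j l hjl h1
      · exact hsub i l hil h2
    · exact hsub i j hij h3

/-- Casts `1, …, 49` of use are non-zero for `p ≥ 11`; the exponents `2,3,5,3,4,7,7` are `≥ 2` and non-zero in `k`. [plumbing] -/
theorem casts (p : ℕ) [Fact p.Prime] (hp : 11 ≤ p) [CharP k p] :
    (∀ i : Fin 7, ((![2, 3, 5, 3, 4, 7, 7] : Fin 7 → ℕ) i) ≠ 0 ∧ 2 ≤ (![2, 3, 5, 3, 4, 7, 7] : Fin 7 → ℕ) i ∧ ((((![2, 3, 5, 3, 4, 7, 7] : Fin 7 → ℕ) i : ℕ) : k) ≠ 0)) ∧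
    (∀ i : Fin 7, (fun i : Fin 7 => (((i : ℕ) + 1 : ℕ) : k)) i ≠ 0) ∧ (∀ i : Fin 7, (fun i : Fin 7 => ((((i : ℕ) + 1) ^ 2 : ℕ) : k)) i ≠ 0) := by
  have hk : ∀ m : ℕ, 0 < m → m < 11 → (m : k) ≠ 0 := fun m hm hm' => DiagonalBPCIRow.natCast_ne_zero_of_lt p m hm (by omega)
  refine ⟨fun i => ⟨?_, ?_, hk _ ?_ ?_⟩, fun i => hk _ (Nat.succ_pos _) (by have := i.2; omega), fun i => ?_⟩
  · fin_cases i <;> simp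
  · fin_cases i <;> simp
  · fin_cases i <;> simp
  · fin_cases i <;> simp
  · simp only [Nat.cast_pow]
    exact pow_ne_zero _ (hk _ (Nat.succ_pos _) (by have := i.2; omega))

end Summit.ResolutionOfSingularities.ResolutionOfSingularities.Theorems.FInjectiveMacaulayfication.DiagonalBPTripleSpecimen

end
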